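import Summits.CriticalPhenomena.PercolationContinuityZ3.Theorems.PercNearOneGluingAdditiveGluingBlockMultiEdge
import Summits.CriticalPhenomena.PercolationContinuityZ3.Theorems.PercNearOneGluingAdditiveGluingTFingers
import HarnessLib

/-! # Crux `PercNearOneGluing.AdditiveGluing` (stmt-CriticalPhenomena-4576) — the finger multi-edge Lemma 3 (registered open stub
# `stub_fingerML3_vp`): the cases settled by the landed tools, in the stub's own vocabulary (seat (b) V⁺-form, depth prover `png-dp-vplus`)

Support file (`--supports stmt-CriticalPhenomena-4576`); no definitions, no named facts.  Companions: `…AdditiveGluingBlockMultiEdge.lean`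
(block multi-edge Lemma 3, single witness), `…AdditiveGluingTFingers.lean` (FML3 ⟹ `AdditiveGluing` for the finger class).

Setting of `stub_fingerML3_vp`: a weighting `K` on `Fin n`, relays `A ∋ b`, a non-empty FINGER block `N` (`Disjoint N A`, every positive-weight
pair at `N` goes to `A` or stays inside `N`), `g = K/N` the glued weighting (`1` on the non-loop pairs inside `N`), `R` = "some pair `N–A` is
open", and the conclusion  `μ_g(R ∩ {d ↔ b}) ≤ μ_g(R ∩ ⋃_{v∈N}{v ↔ b})`  (FML3(d)).  The stub asks for FML3(d) when `d ∈ A` minimises the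
UNGLUED two-point function `μ_K(· ↔ b)` over `A`.  This file proves FML3(d) in the following cases (`q` = `K` with every pair at `N` killed,
the "star-killed" weighting of the T-form files):
* `fingerML3_of_gluedWitness`: `μ_g(d ↔ b) ≤ μ_g(c ↔ b)` for some vertex `c ∉ N` with `μ_q(c ↔ b) ≤ μ_q(a ↔ b)` for all `a ∈ A` — e.g. `c` =
  the Question-9 designation of the block (`argmin_A μ_q(· ↔ b)`), or `c = d` itself when `d` is `q`-minimal (`fingerML3_of_qMinimal`).
  (`block_multiEdge_singleWitness` + the locality identity `μ_{pinW g F ∅}(y ↔ b) = μ_q(y ↔ b)` off the block, `openConn_real_eq_offBlock`.)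
* `fingerML3_of_le_block`, `fingerML3_of_le_blockVertex`: `μ_g(d ↔ b) ≤ μ_g(N ↔ b)`, in particular (gluing Lemma 5) whenever
  `μ_K(d ↔ b) ≤ μ_K(v ↔ b)` for some block vertex `v ∈ N` in the UNGLUED weighting.
* `fingerML3_iff_dPairsKilled`: FML3(d) for `K` ⟺ FML3(d) for `K` with the pairs `N–d` killed (on "some pair `v–d` open", `d ≡ N` almost
  surely, so those patterns contribute equally to both sides) — the comparison vertex may be assumed non-adjacent to the block.
What is NOT proved: the transfer from the stub's unglued hypothesis `μ_K(d↔b) ≤ μ_K(a↔b)` (`a ∈ A`) to one of these.  Depth-prover numerics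
(exact enumeration, n ≤ 8, ≈ 2 500 instances satisfying the stub's hypothesis, all un-gluings incl. corners): FML3 0 failures; the cases above
cover every instance found (the glued witness alone all but ≈ 0.6 %, which have `d` adjacent to `N` and fall to `fingerML3_of_le_blockVertex`).
[cite: KozmaNitzan2024, Lemma 3(i) (pp. 6–7), Lemma 5 (p. 13), §3.2 pp. 12–14, Question 9 (p. 36)]
-/

namespace Summit.CriticalPhenomena.PercolationContinuityZ3.Theorems

open MeasureTheory Set
open Literature.Probability.LatticeModels (prodBernoulli)
open Literature.Probability.Percolation (BondConfig openConn openGraph openCluster openEdgeCluster pinW localCylinder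
  DeterminedBy determinedBy_iff)

noncomputable section
open Classical

section FingerML3Reductions

open Literature.Probability.LatticeModels Literature.Probability.Percolation

variable {n : ℕ}

/-! ### Locality: reliabilities off a cut-off block do not feel the weights at the block -/

/-- **Locality off a block.**  If two weightings agree on the pairs avoiding `N` and both vanish on the pairs joining `N` to its complement,
then `μ_p(y ↔ b) = μ_q(y ↔ b)` for every `y ∉ N`: almost surely no open pair leaves `Nᶜ`, so the cluster of `y` is the cluster of `y` in the
configuration restricted to the pairs avoiding `N` (`openCluster_eq_openCluster_inter`), an event determined by those pairs.
[folklore; Grimmett 1999 §2.2] -/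
theorem openConn_real_eq_offBlock (p q : Sym2 (Fin n) → unitInterval) (N : Finset (Fin n)) {y : Fin n} (b : Fin n)
    (hy : y ∉ N) (hin : ∀ e : Sym2 (Fin n), (∀ z ∈ e, z ∉ N) → p e = q e)
    (hp : ∀ u : Fin n, u ∉ N → ∀ v ∈ N, p s(u, v) = 0) (hq : ∀ u : Fin n, u ∉ N → ∀ v ∈ N, q s(u, v) = 0) :
    (prodBernoulli p).real (openConn y b) = (prodBernoulli q).real (openConn y b) := by
  set E : Set (Sym2 (Fin n)) := {e | ∀ z ∈ e, z ∈ ({z : Fin n | z ∉ N} : Set (Fin n))} with hE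
  set X : Set (BondConfig (Fin n)) := {ω | b ∈ openCluster (ω ∩ E) y} with hX
  set L : Set (BondConfig (Fin n)) := {ω | ∃ u : Fin n, u ∉ N ∧ ∃ v ∈ N, s(u, v) ∈ ω} with hL
  set Tc : Finset (Sym2 (Fin n)) :=
    ((Finset.univ.filter fun u : Fin n => u ∉ N) ×ˢ N).image (fun uv => s(uv.1, uv.2)) with hTc
  -- the crossing event is null under both weightings
  have hnull : ∀ r : Sym2 (Fin n) → unitInterval, (∀ u : Fin n, u ∉ N → ∀ v ∈ N, r s(u, v) = 0) →
      (prodBernoulli r).real L = 0 := by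
    intro r hr
    refine sigmaRec_null r L Tc ?_ ?_
    · intro e he
      obtain ⟨⟨u, v⟩, huv, rfl⟩ := Finset.mem_image.1 he
      obtain ⟨hu, hv⟩ := Finset.mem_product.1 huv
      exact hr u (Finset.mem_filter.1 hu).2 v hv
    · rintro ω ⟨u, hu, v, hv, huv⟩
      refine ⟨s(u, v), Finset.mem_image.2 ⟨(u, v), ?_, rfl⟩, huv⟩
      exact Finset.mem_product.2 ⟨Finset.mem_filter.2 ⟨Finset.mem_univ _, hu⟩, hv⟩
  -- off the crossing event, `{y ↔ b}` is the restricted-cluster event `X`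
  have hiff : ∀ ω : BondConfig (Fin n), ω ∉ L → (ω ∈ openConn y b ↔ ω ∈ X) := by
    intro ω hω
    have hN' : ∀ u ∈ ({z : Fin n | z ∉ N} : Set (Fin n)), ∀ v ∉ ({z : Fin n | z ∉ N} : Set (Fin n)), s(u, v) ∉ ω := by
      intro u hu v hv huv
      exact hω ⟨u, hu, v, not_not.1 hv, huv⟩
    have hcl := openCluster_eq_openCluster_inter (ω := ω) (x := y) (S := {z : Fin n | z ∉ N}) hy hN'
    show (openGraph ω).Reachable y b ↔ b ∈ openCluster (ω ∩ E) y
    rw [show ((openGraph ω).Reachable y b) = (b ∈ openCluster ω y) from rfl, hcl]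
  have hmeas : ∀ s : Set (BondConfig (Fin n)), MeasurableSet s := fun _ => MeasurableSet.of_discrete
  have hsame : ∀ r : Sym2 (Fin n) → unitInterval, (∀ u : Fin n, u ∉ N → ∀ v ∈ N, r s(u, v) = 0) →
      (prodBernoulli r).real (openConn y b) = (prodBernoulli r).real X := by
    intro r hr
    have h0 := hnull r hr
    have h1 : (prodBernoulli r).real (openConn y b) ≤ (prodBernoulli r).real X + (prodBernoulli r).real L := by
      refine (measureReal_mono (μ := prodBernoulli r) ?_ (measure_ne_top _ _)).trans
        (measureReal_union_le X L)
      intro ω hω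
      by_cases hωL : ω ∈ L
      · exact Or.inr hωL
      · exact Or.inl ((hiff ω hωL).1 hω)
    have h2 : (prodBernoulli r).real X ≤ (prodBernoulli r).real (openConn y b) + (prodBernoulli r).real L := by
      refine (measureReal_mono (μ := prodBernoulli r) ?_ (measure_ne_top _ _)).trans
        (measureReal_union_le (openConn y b) L)
      intro ω hω
      by_cases hωL : ω ∈ L
      · exact Or.inr hωL
      · exact Or.inl ((hiff ω hωL).2 hω)
    linarith
  -- `X` is determined by the pairs avoiding `N`, on which `p` and `q` agree
  have hXdet : DeterminedBy X E := by
    rw [determinedBy_iff]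
    intro ω ω' hωω'
    simp only [hX, Set.mem_setOf_eq, hωω']
  rw [hsame p hp, hsame q hq]
  exact prodBernoulli_real_eq_of_determinedBy p q (fun e he => hin e he) hXdet (hmeas X)

/-! ### The finger setting: gluing, killing, contact pairs -/

/-- The contact pairs `N × A` as a `Finset` of unordered pairs, and the identification of the stub's event `R`. [folklore] -/
theorem fingerContact_R_eq (N A : Finset (Fin n)) :
    ({ω : Set (Sym2 (Fin n)) | ∃ v ∈ N, ∃ a ∈ A, s(v, a) ∈ ω} : Set (BondConfig (Fin n))) =
      {ω | ∃ e ∈ (N ×ˢ A).image (fun va : Fin n × Fin n => s(va.1, va.2)), e ∈ ω} := by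
  ext ω
  simp only [Set.mem_setOf_eq, Finset.mem_image, Finset.mem_product]
  constructor
  · rintro ⟨v, hv, a, ha, h⟩; exact ⟨s(v, a), ⟨(v, a), ⟨hv, ha⟩, rfl⟩, h⟩
  · rintro ⟨e, ⟨⟨v, a⟩, ⟨hv, ha⟩, rfl⟩, h⟩; exact ⟨v, hv, a, ha, h⟩

/-- **FML3 from a block comparison.**  Finger setting; if `μ_g(d ↔ b) ≤ μ_g(⋃_{v∈N} v ↔ b)` in the glued weighting `g = K/N`, then
`μ_g(R ∩ {d↔b}) ≤ μ_g(R ∩ ⋃_{v∈N}{v↔b})`: off `R` the glued finger block reaches no relay (`finger_noContact_reach_null`), so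
`μ_g(⋃_v v↔b) = μ_g(R ∩ ⋃_v v↔b)`. [cite: KozmaNitzan2024, §3.2 pp. 12–14] -/
theorem fingerML3_of_le_block (K : Sym2 (Fin n) → unitInterval) (A N : Finset (Fin n)) (d b : Fin n)
    (hb : b ∈ A) (hNA : Disjoint N A)
    (hfree : ∀ v ∈ N, ∀ y : Fin n, y ∉ A → y ∉ N → (K s(v, y) : ℝ) = 0)
    (hle : (prodBernoulli (fun e' : Sym2 (Fin n) => if (∀ y ∈ e', y ∈ N) ∧ ¬ e'.IsDiag then 1 else K e')).real (openConn d b) ≤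
      (prodBernoulli (fun e' : Sym2 (Fin n) => if (∀ y ∈ e', y ∈ N) ∧ ¬ e'.IsDiag then 1 else K e')).real
        (⋃ v ∈ N, openConn v b)) :
    (prodBernoulli (fun e' : Sym2 (Fin n) => if (∀ y ∈ e', y ∈ N) ∧ ¬ e'.IsDiag then 1 else K e')).real
        ({ω : Set (Sym2 (Fin n)) | ∃ v ∈ N, ∃ a ∈ A, s(v, a) ∈ ω} ∩ openConn d b) ≤
      (prodBernoulli (fun e' : Sym2 (Fin n) => if (∀ y ∈ e', y ∈ N) ∧ ¬ e'.IsDiag then 1 else K e')).real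
        ({ω : Set (Sym2 (Fin n)) | ∃ v ∈ N, ∃ a ∈ A, s(v, a) ∈ ω} ∩ ⋃ v ∈ N, openConn v b) := by
  set g : Sym2 (Fin n) → unitInterval := fun e' => if (∀ y ∈ e', y ∈ N) ∧ ¬ e'.IsDiag then 1 else K e' with hg
  set R : Set (BondConfig (Fin n)) := {ω : Set (Sym2 (Fin n)) | ∃ v ∈ N, ∃ a ∈ A, s(v, a) ∈ ω} with hR
  have hmeas : ∀ s : Set (BondConfig (Fin n)), MeasurableSet s := fun _ => MeasurableSet.of_discrete
  -- the finger condition survives gluing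
  have hfree' : ∀ v ∈ N, ∀ y : Fin n, y ∉ A → y ∉ N → (g s(v, y) : ℝ) = 0 := by
    intro v hv y hyA hyN
    have : ¬ ((∀ z ∈ s(v, y), z ∈ N) ∧ ¬ (s(v, y)).IsDiag) := fun h => hyN (h.1 y (Sym2.mem_mk_right v y))
    simp only [hg, this, if_false]
    exact hfree v hv y hyA hyN
  have hnull := finger_noContact_reach_null g A N hNA hfree'
  -- `μ_g(⋃ v↔b) ≤ μ_g(R ∩ ⋃ v↔b)` since the part off `R` is null
  have hsplit := measureReal_inter_add_sdiff (μ := prodBernoulli g) (s := ⋃ v ∈ N, openConn v b) (hmeas R)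
    (measure_ne_top _ _)
  have hoff : (prodBernoulli g).real ((⋃ v ∈ N, openConn v b) \ R) = 0 := by
    refine le_antisymm ((measureReal_mono (μ := prodBernoulli g) ?_ (measure_ne_top _ _)).trans hnull.le)
      measureReal_nonneg
    rintro ω ⟨hω, hωR⟩
    refine ⟨hωR, ?_⟩
    obtain ⟨v, hv, hvb⟩ : ∃ v ∈ N, ω ∈ openConn v b := by
      simpa only [Set.mem_iUnion, exists_prop] using hω
    simp only [Set.mem_iUnion, exists_prop]
    exact ⟨v, hv, b, hb, hvb⟩
  calc (prodBernoulli g).real (R ∩ openConn d b)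
      ≤ (prodBernoulli g).real (openConn d b) := measureReal_mono Set.inter_subset_right (measure_ne_top _ _)
    _ ≤ (prodBernoulli g).real (⋃ v ∈ N, openConn v b) := hle
    _ = (prodBernoulli g).real ((⋃ v ∈ N, openConn v b) ∩ R) := by rw [← hsplit, hoff, add_zero]
    _ = (prodBernoulli g).real (R ∩ ⋃ v ∈ N, openConn v b) := by rw [Set.inter_comm]

/-- **FML3 when `d` is below a block vertex in the UNGLUED weighting.**  Finger setting; if `μ_K(d ↔ b) ≤ μ_K(v ↔ b)` for some `v ∈ N`,
then FML3(d): gluing Lemma 5 (`glueBlock_lemma5_delta`, `δ = 0`) gives `μ_g(d↔b) ≤ μ_g(N↔b)`, then `fingerML3_of_le_block`.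
[cite: KozmaNitzan2024, Lemma 5 (p. 13)] -/
theorem fingerML3_of_le_blockVertex (K : Sym2 (Fin n) → unitInterval) (A N : Finset (Fin n)) (d b v : Fin n)
    (hb : b ∈ A) (hNA : Disjoint N A) (hv : v ∈ N)
    (hfree : ∀ v ∈ N, ∀ y : Fin n, y ∉ A → y ∉ N → (K s(v, y) : ℝ) = 0)
    (hle : (prodBernoulli K).real (openConn d b) ≤ (prodBernoulli K).real (openConn v b)) :
    (prodBernoulli (fun e' : Sym2 (Fin n) => if (∀ y ∈ e', y ∈ N) ∧ ¬ e'.IsDiag then 1 else K e')).real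
        ({ω : Set (Sym2 (Fin n)) | ∃ v ∈ N, ∃ a ∈ A, s(v, a) ∈ ω} ∩ openConn d b) ≤
      (prodBernoulli (fun e' : Sym2 (Fin n) => if (∀ y ∈ e', y ∈ N) ∧ ¬ e'.IsDiag then 1 else K e')).real
        ({ω : Set (Sym2 (Fin n)) | ∃ v ∈ N, ∃ a ∈ A, s(v, a) ∈ ω} ∩ ⋃ v ∈ N, openConn v b) := by
  have h5 := glueBlock_lemma5_delta K N d v b hv le_rfl (by simpa using hle)
  rw [add_zero] at h5
  exact fingerML3_of_le_block K A N d b hb hNA hfree h5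

/-- **FML3 from a GLUED single witness, star-killed vocabulary.**  Finger setting, `q` = `K` with every pair at `N` killed.  If `c ∉ N`
satisfies `μ_q(c ↔ b) ≤ μ_q(a ↔ b)` for all `a ∈ A` (e.g. the block's Question-9 designation) and `μ_g(d ↔ b) ≤ μ_g(c ↔ b)` in the glued
weighting `g = K/N`, then FML3(d).  (`block_multiEdge_singleWitness` with the contact set `N × A`; its base weighting `pinW g F ∅` and `q`
give the same reliabilities off the block by `openConn_real_eq_offBlock`.)
[cite: KozmaNitzan2024, Lemma 3(i) (pp. 6–7), Lemma 5 (p. 13), Question 9 (p. 36)] -/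
theorem fingerML3_of_gluedWitness (K : Sym2 (Fin n) → unitInterval) (A N : Finset (Fin n)) (d c b : Fin n)
    (hNA : Disjoint N A) (hc : c ∉ N)
    (hfree : ∀ v ∈ N, ∀ y : Fin n, y ∉ A → y ∉ N → (K s(v, y) : ℝ) = 0)
    (hcA : ∀ a ∈ A,
      (prodBernoulli (fun e' : Sym2 (Fin n) => if (∃ y ∈ e', y ∈ N) then (0 : unitInterval) else K e')).real (openConn c b) ≤
        (prodBernoulli (fun e' : Sym2 (Fin n) => if (∃ y ∈ e', y ∈ N) then (0 : unitInterval) else K e')).real (openConn a b))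
    (hle : (prodBernoulli (fun e' : Sym2 (Fin n) => if (∀ y ∈ e', y ∈ N) ∧ ¬ e'.IsDiag then 1 else K e')).real (openConn d b) ≤
      (prodBernoulli (fun e' : Sym2 (Fin n) => if (∀ y ∈ e', y ∈ N) ∧ ¬ e'.IsDiag then 1 else K e')).real (openConn c b)) :
    (prodBernoulli (fun e' : Sym2 (Fin n) => if (∀ y ∈ e', y ∈ N) ∧ ¬ e'.IsDiag then 1 else K e')).real
        ({ω : Set (Sym2 (Fin n)) | ∃ v ∈ N, ∃ a ∈ A, s(v, a) ∈ ω} ∩ openConn d b) ≤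
      (prodBernoulli (fun e' : Sym2 (Fin n) => if (∀ y ∈ e', y ∈ N) ∧ ¬ e'.IsDiag then 1 else K e')).real
        ({ω : Set (Sym2 (Fin n)) | ∃ v ∈ N, ∃ a ∈ A, s(v, a) ∈ ω} ∩ ⋃ v ∈ N, openConn v b) := by
  set g : Sym2 (Fin n) → unitInterval := fun e' => if (∀ y ∈ e', y ∈ N) ∧ ¬ e'.IsDiag then 1 else K e' with hg
  set q : Sym2 (Fin n) → unitInterval := fun e' => if (∃ y ∈ e', y ∈ N) then (0 : unitInterval) else K e' with hq
  set F : Finset (Sym2 (Fin n)) := (N ×ˢ A).image (fun va : Fin n × Fin n => s(va.1, va.2)) with hFdef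
  rw [fingerContact_R_eq N A]
  -- shape of the contact pairs and the glued clique
  have hF : ∀ e ∈ F, ∃ v ∈ N, ∃ a ∉ N, e = s(v, a) := by
    intro e he
    obtain ⟨⟨v, a⟩, hva, rfl⟩ := Finset.mem_image.1 he
    obtain ⟨hv, ha⟩ := Finset.mem_product.1 hva
    exact ⟨v, hv, a, Finset.disjoint_left.1 hNA.symm ha, rfl⟩
  have hglue : ∀ u ∈ N, ∀ u' ∈ N, u ≠ u' → g s(u, u') = 1 := by
    intro u hu u' hu' huu'
    have : (∀ z ∈ s(u, u'), z ∈ N) ∧ ¬ (s(u, u')).IsDiag := by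
      refine ⟨fun z hz => ?_, fun h => huu' (Sym2.mk_isDiag_iff.1 h)⟩
      rcases Sym2.mem_iff.1 hz with rfl | rfl
      · exact hu
      · exact hu'
    show (if (∀ y ∈ s(u, u'), y ∈ N) ∧ ¬ (s(u, u')).IsDiag then (1 : unitInterval) else K s(u, u')) = 1
    rw [if_pos this]
  -- the base weighting `pinW g F ∅` and `q` agree off the block and both cut the block off
  set w₀ : Sym2 (Fin n) → unitInterval := pinW g (↑F : Set (Sym2 (Fin n))) ↑(∅ : Finset (Sym2 (Fin n))) with hw₀
  have hin : ∀ e : Sym2 (Fin n), (∀ z ∈ e, z ∉ N) → w₀ e = q e := by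
    intro e he
    have heF : e ∉ (↑F : Set (Sym2 (Fin n))) := by
      intro heF
      obtain ⟨v, hv, a, -, rfl⟩ := hF e (Finset.mem_coe.1 heF)
      exact he v (Sym2.mem_mk_left v a) hv
    rw [hw₀, pinW_apply_of_not_mem g _ heF]
    have h1 : ¬ ((∀ y ∈ e, y ∈ N) ∧ ¬ e.IsDiag) := by
      induction e using Sym2.ind with
      | h u u' => exact fun h => he u (Sym2.mem_mk_left u u') (h.1 u (Sym2.mem_mk_left u u'))
    have h2 : ¬ (∃ y ∈ e, y ∈ N) := fun ⟨y, hy, hyN⟩ => he y hy hyN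
    simp only [hg, hq, h1, h2, if_false]
  have hw₀cut : ∀ u : Fin n, u ∉ N → ∀ v ∈ N, w₀ s(u, v) = 0 := by
    intro u hu v hv
    by_cases huA : u ∈ A
    · have he : s(u, v) ∈ (↑F : Set (Sym2 (Fin n))) := by
        refine Finset.mem_coe.2 (Finset.mem_image.2 ⟨(v, u), Finset.mem_product.2 ⟨hv, huA⟩, ?_⟩)
        exact Sym2.eq_swap
      rw [hw₀, pinW_apply_of_mem_of_not_mem g he (by simp)]
    · have he : s(u, v) ∉ (↑F : Set (Sym2 (Fin n))) := by
        intro heF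
        obtain ⟨⟨v', a'⟩, hva, he'⟩ := Finset.mem_image.1 (Finset.mem_coe.1 heF)
        obtain ⟨hv', ha'⟩ := Finset.mem_product.1 hva
        dsimp only at he'
        rcases Sym2.eq_iff.1 he' with ⟨h1, h2⟩ | ⟨h1, h2⟩
        · exact hu (h1 ▸ hv')
        · exact huA (h2 ▸ ha')
      rw [hw₀, pinW_apply_of_not_mem g _ he]
      have h1 : ¬ ((∀ y ∈ s(u, v), y ∈ N) ∧ ¬ (s(u, v)).IsDiag) := fun h => hu (h.1 u (Sym2.mem_mk_left u v))
      simp only [hg, h1, if_false]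
      have := hfree v hv u huA hu
      rw [Sym2.eq_swap]
      exact Subtype.ext (by exact_mod_cast this)
  have hqcut : ∀ u : Fin n, u ∉ N → ∀ v ∈ N, q s(u, v) = 0 := by
    intro u hu v hv
    have : ∃ y ∈ s(u, v), y ∈ N := ⟨v, Sym2.mem_mk_right u v, hv⟩
    simp only [hq, this, if_true]
  have hloc : ∀ y : Fin n, y ∉ N → (prodBernoulli w₀).real (openConn y b) = (prodBernoulli q).real (openConn y b) :=
    fun y hy => openConn_real_eq_offBlock w₀ q N b hy hin hw₀cut hqcut
  -- the witness hypotheses in the `pinW` vocabulary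
  have hstar : ∀ v ∈ N, ∀ a ∉ N, s(v, a) ∈ F →
      (prodBernoulli w₀).real (openConn c b) ≤ (prodBernoulli w₀).real (openConn a b) := by
    intro v hv a haN hva
    have haA : a ∈ A := by
      obtain ⟨⟨v', a'⟩, hva', he'⟩ := Finset.mem_image.1 hva
      obtain ⟨hv', ha'⟩ := Finset.mem_product.1 hva'
      dsimp only at he'
      rcases Sym2.eq_iff.1 he' with ⟨h1, h2⟩ | ⟨h1, h2⟩
      · exact h2 ▸ ha'
      · exact (haN (h1 ▸ hv')).elim
    rw [hloc c hc, hloc a haN]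
    exact hcA a haA
  exact block_multiEdge_singleWitness g N F hF hglue d c b hstar hle

/-- **FML3 when `d` is the block's Question-9 designation** (`d` itself `q`-minimal over `A`): no hypothesis in `K` or `K/N` is needed —
the glued block beats, on `R`, every vertex that is least reliable once the block is deleted (the block version of `multiEdge_core`).
[cite: KozmaNitzan2024, §3.2 pp. 12–14, Question 9 (p. 36)] -/
theorem fingerML3_of_qMinimal (K : Sym2 (Fin n) → unitInterval) (A N : Finset (Fin n)) (d b : Fin n)
    (hNA : Disjoint N A) (hd : d ∈ A)
    (hfree : ∀ v ∈ N, ∀ y : Fin n, y ∉ A → y ∉ N → (K s(v, y) : ℝ) = 0)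
    (hdA : ∀ a ∈ A,
      (prodBernoulli (fun e' : Sym2 (Fin n) => if (∃ y ∈ e', y ∈ N) then (0 : unitInterval) else K e')).real (openConn d b) ≤
        (prodBernoulli (fun e' : Sym2 (Fin n) => if (∃ y ∈ e', y ∈ N) then (0 : unitInterval) else K e')).real (openConn a b)) :
    (prodBernoulli (fun e' : Sym2 (Fin n) => if (∀ y ∈ e', y ∈ N) ∧ ¬ e'.IsDiag then 1 else K e')).real
        ({ω : Set (Sym2 (Fin n)) | ∃ v ∈ N, ∃ a ∈ A, s(v, a) ∈ ω} ∩ openConn d b) ≤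
      (prodBernoulli (fun e' : Sym2 (Fin n) => if (∀ y ∈ e', y ∈ N) ∧ ¬ e'.IsDiag then 1 else K e')).real
        ({ω : Set (Sym2 (Fin n)) | ∃ v ∈ N, ∃ a ∈ A, s(v, a) ∈ ω} ∩ ⋃ v ∈ N, openConn v b) :=
  fingerML3_of_gluedWitness K A N d d b hNA (Finset.disjoint_left.1 hNA.symm hd) hfree hdA le_rfl

/-- Registered rung `stub_fingerML3OfGluedWitness_vp` of crux stmt-CriticalPhenomena-4576 (depth prover png-dp-vplus, seat (b) V⁺-form): FML3
(the conclusion of `stub_fingerML3_vp`) from a glued single witness — `fingerML3_of_gluedWitness`, closed statement.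
[cite: KozmaNitzan2024, Lemma 3(i) (pp. 6–7), Lemma 5 (p. 13), Question 9 (p. 36)] -/
theorem stub_fingerML3OfGluedWitness_vp : ∀ (n : ℕ) (K : Sym2 (Fin n) → unitInterval) (A N : Finset (Fin n)) (d c b : Fin n), Disjoint N A → c ∉ N → (∀ v ∈ N, ∀ y : Fin n, y ∉ A → y ∉ N → (K s(v, y) : ℝ) = 0) → (∀ a ∈ A, (Literature.Probability.LatticeModels.prodBernoulli (fun e' : Sym2 (Fin n) => if (∃ y ∈ e', y ∈ N) then (0 : unitInterval) else K e')).real (Literature.Probability.Percolation.openConn c b) ≤ (Literature.Probability.LatticeModels.prodBernoulli (fun e' : Sym2 (Fin n) => if (∃ y ∈ e', y ∈ N) then (0 : unitInterval) else K e')).real (Literature.Probability.Percolation.openConn a b)) → (Literature.Probability.LatticeModels.prodBernoulli (fun e' : Sym2 (Fin n) => if (∀ y ∈ e', y ∈ N) ∧ ¬ e'.IsDiag then 1 else K e')).real (Literature.Probability.Percolation.openConn d b) ≤ (Literature.Probability.LatticeModels.prodBernoulli (fun e' : Sym2 (Fin n) => if (∀ y ∈ e', y ∈ N) ∧ ¬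 e'.IsDiag then 1 else K e')).real (Literature.Probability.Percolation.openConn c b) → (Literature.Probability.LatticeModels.prodBernoulli (fun e' : Sym2 (Fin n) => if (∀ y ∈ e', y ∈ N) ∧ ¬ e'.IsDiag then 1 else K e')).real ({ω : Set (Sym2 (Fin n)) | ∃ v ∈ N, ∃ a ∈ A, s(v, a) ∈ ω} ∩ Literature.Probability.Percolation.openConn d b) ≤ (Literature.Probability.LatticeModels.prodBernoulli (fun e' : Sym2 (Fin n) => if (∀ y ∈ e', y ∈ N) ∧ ¬ e'.IsDiag then 1 else K e')).real ({ω : Set (Sym2 (Fin n)) | ∃ v ∈ N, ∃ a ∈ A, s(v, a) ∈ ω} ∩ ⋃ v ∈ N, Literature.Probability.Percolation.openConn v b) :=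
  fun _ K A N d c b hNA hc hfree hcA hle => fingerML3_of_gluedWitness K A N d c b hNA hc hfree hcA hle

/-- **FML3 does not feel the pairs `N–d`.**  Finger setting, `d ∈ A`, `d ∉ N`; let `K'` be `K` with the pairs `s(v, d)` (`v ∈ N`) killed.
If FML3(d) holds for `K'`, i.e. `μ_{g'}(R ∩ {d↔b}) ≤ μ_{g'}(R ∩ ⋃_v{v↔b})` for `g' = K'/N`, then FML3(d) holds for `K`.  Proof: split along
`C` = "all pairs `N–d` closed"; on `C` the glued weighting conditions to `g'` (`prodBernoulli_real_inter_localCylinder`); off `C` the vertex `d`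
is attached to the glued block, `R` holds (`d ∈ A`), and `{d ↔ b} = {N ↔ b}` almost surely, so the two sides agree there.  Hence the
comparison vertex of FML3 may be assumed non-adjacent to the block. [cite: KozmaNitzan2024, §3.2 pp. 12–14] -/
theorem fingerML3_of_dPairsKilled (K : Sym2 (Fin n) → unitInterval) (A N : Finset (Fin n)) (d b : Fin n)
    (hd : d ∈ A) (hdN : d ∉ N)
    (hK' : (prodBernoulli (fun e' : Sym2 (Fin n) => if (∀ y ∈ e', y ∈ N) ∧ ¬ e'.IsDiag then 1 else
              if (∃ v ∈ N, e' = s(v, d)) then (0 : unitInterval) else K e')).real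
          ({ω : Set (Sym2 (Fin n)) | ∃ v ∈ N, ∃ a ∈ A, s(v, a) ∈ ω} ∩ openConn d b) ≤
        (prodBernoulli (fun e' : Sym2 (Fin n) => if (∀ y ∈ e', y ∈ N) ∧ ¬ e'.IsDiag then 1 else
              if (∃ v ∈ N, e' = s(v, d)) then (0 : unitInterval) else K e')).real
          ({ω : Set (Sym2 (Fin n)) | ∃ v ∈ N, ∃ a ∈ A, s(v, a) ∈ ω} ∩ ⋃ v ∈ N, openConn v b)) :
    (prodBernoulli (fun e' : Sym2 (Fin n) => if (∀ y ∈ e', y ∈ N) ∧ ¬ e'.IsDiag then 1 else K e')).real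
        ({ω : Set (Sym2 (Fin n)) | ∃ v ∈ N, ∃ a ∈ A, s(v, a) ∈ ω} ∩ openConn d b) ≤
      (prodBernoulli (fun e' : Sym2 (Fin n) => if (∀ y ∈ e', y ∈ N) ∧ ¬ e'.IsDiag then 1 else K e')).real
        ({ω : Set (Sym2 (Fin n)) | ∃ v ∈ N, ∃ a ∈ A, s(v, a) ∈ ω} ∩ ⋃ v ∈ N, openConn v b) := by
  set g : Sym2 (Fin n) → unitInterval := fun e' => if (∀ y ∈ e', y ∈ N) ∧ ¬ e'.IsDiag then 1 else K e' with hg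
  set g' : Sym2 (Fin n) → unitInterval := fun e' => if (∀ y ∈ e', y ∈ N) ∧ ¬ e'.IsDiag then 1 else
    if (∃ v ∈ N, e' = s(v, d)) then (0 : unitInterval) else K e' with hg'
  set R : Set (BondConfig (Fin n)) := {ω : Set (Sym2 (Fin n)) | ∃ v ∈ N, ∃ a ∈ A, s(v, a) ∈ ω} with hR
  set U : Set (BondConfig (Fin n)) := ⋃ v ∈ N, openConn v b with hU
  set Fd : Finset (Sym2 (Fin n)) := N.image (fun v => s(v, d)) with hFd
  set C : Set (BondConfig (Fin n)) := localCylinder (↑Fd : Set (Sym2 (Fin n))) (∅ : Set (Sym2 (Fin n))) with hC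
  have hmeas : ∀ s : Set (BondConfig (Fin n)), MeasurableSet s := fun _ => MeasurableSet.of_discrete
  -- `g'` is `g` pinned along `Fd` with the empty pattern
  have hpin : pinW g (↑Fd : Set (Sym2 (Fin n))) (∅ : Set (Sym2 (Fin n))) = g' := by
    funext e
    by_cases he : e ∈ (↑Fd : Set (Sym2 (Fin n)))
    · rw [pinW_apply_of_mem_of_not_mem g he (Set.notMem_empty e)]
      obtain ⟨v, hv, rfl⟩ := Finset.mem_image.1 (Finset.mem_coe.1 he)
      have h1 : ¬ ((∀ y ∈ s(v, d), y ∈ N) ∧ ¬ (s(v, d)).IsDiag) := fun h => hdN (h.1 d (Sym2.mem_mk_right v d))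
      have h2 : ∃ v' ∈ N, s(v, d) = s(v', d) := ⟨v, hv, rfl⟩
      simp only [hg', h1, h2, if_false, if_true]
    · rw [pinW_apply_of_not_mem g _ he]
      have h2 : ¬ (∃ v ∈ N, e = s(v, d)) := by
        rintro ⟨v, hv, rfl⟩
        exact he (Finset.mem_coe.2 (Finset.mem_image.2 ⟨v, hv, rfl⟩))
      show (if (∀ y ∈ e, y ∈ N) ∧ ¬ e.IsDiag then (1 : unitInterval) else K e) =
        (if (∀ y ∈ e, y ∈ N) ∧ ¬ e.IsDiag then (1 : unitInterval) else if (∃ v ∈ N, e = s(v, d)) then 0 else K e)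
      rw [if_neg h2]
  -- membership in `C`: every pair `N–d` is closed
  have hmemC : ∀ ω : BondConfig (Fin n), ω ∈ C ↔ ∀ v ∈ N, s(v, d) ∉ ω := by
    intro ω
    simp only [hC, localCylinder, Set.mem_setOf_eq, Set.mem_empty_iff_false, iff_false, hFd, Finset.coe_image,
      Set.mem_image, Finset.mem_coe, forall_exists_index, and_imp, forall_apply_eq_imp_iff₂]
  -- on `C`: conditioning is the killed weighting
  have hon : ∀ X : Set (BondConfig (Fin n)), (prodBernoulli g).real (X ∩ C) =
      (prodBernoulli g).real C * (prodBernoulli g').real X := by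
    intro X
    rw [hC, prodBernoulli_real_inter_localCylinder g Fd (∅ : Set (Sym2 (Fin n))) (hmeas X), hpin]
  -- off `C`: `R` holds and `{d ↔ b} = ⋃_v {v ↔ b}` almost surely
  have hclique : ∀ᵐ ω ∂(prodBernoulli g), ∀ e ∈ Finset.univ.filter (fun e : Sym2 (Fin n) => (∀ y ∈ e, y ∈ N) ∧ ¬ e.IsDiag),
      e ∈ ω := by
    rw [Filter.eventually_all_finset]
    intro e he
    have he2 : (∀ y ∈ e, y ∈ N) ∧ ¬ e.IsDiag := (Finset.mem_filter.1 he).2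
    refine prodBernoulli_ae_mem_of_eq_one g ?_
    show (if (∀ y ∈ e, y ∈ N) ∧ ¬ e.IsDiag then (1 : unitInterval) else K e) = 1
    rw [if_pos he2]
  have hoff : (prodBernoulli g).real ((R ∩ openConn d b) \ C) = (prodBernoulli g).real ((R ∩ U) \ C) := by
    refine measureReal_congr ?_
    filter_upwards [hclique] with ω hω
    have key : ω ∉ C → (ω ∈ R ∩ openConn d b ↔ ω ∈ R ∩ U) := by
      intro hωC
      obtain ⟨v, hv, hvd⟩ : ∃ v ∈ N, s(v, d) ∈ ω := by
        by_contra h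
        push Not at h
        exact hωC ((hmemC ω).2 h)
      have hvd' : v ≠ d := fun h => hdN (h ▸ hv)
      have hadj : (openGraph ω).Reachable v d := SimpleGraph.Adj.reachable ((openGraph_adj ω v d).2 ⟨hvd, hvd'⟩)
      have hRω : ω ∈ R := ⟨v, hv, d, hd, hvd⟩
      constructor
      · rintro ⟨-, hdb⟩
        refine ⟨hRω, ?_⟩
        simp only [hU, Set.mem_iUnion, exists_prop]
        exact ⟨v, hv, hadj.trans hdb⟩
      · rintro ⟨-, hUω⟩
        refine ⟨hRω, ?_⟩
        simp only [hU, Set.mem_iUnion, exists_prop] at hUω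
        obtain ⟨s, hs, hsb⟩ := hUω
        by_cases hsv : s = v
        · subst hsv
          exact hadj.symm.trans hsb
        · have hsv' : (openGraph ω).Reachable v s := by
            refine SimpleGraph.Adj.reachable ((openGraph_adj ω v s).2 ⟨hω _ ?_, fun h => hsv h.symm⟩)
            refine Finset.mem_filter.2 ⟨Finset.mem_univ _, fun y hy => ?_, fun h => hsv (Sym2.mk_isDiag_iff.1 h).symm⟩
            rcases Sym2.mem_iff.1 hy with rfl | rfl
            · exact hv
            · exact hs
          exact hadj.symm.trans (hsv'.trans hsb)
    show (ω ∈ (R ∩ openConn d b) \ C) = (ω ∈ (R ∩ U) \ C)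
    by_cases hωC : ω ∈ C
    · simp only [Set.mem_sdiff, hωC, not_true_eq_false, and_false]
    · exact propext ⟨fun h => ⟨(key hωC).1 h.1, h.2⟩, fun h => ⟨(key hωC).2 h.1, h.2⟩⟩
  -- assemble
  have hs1 := measureReal_inter_add_sdiff (μ := prodBernoulli g) (s := R ∩ openConn d b) (hmeas C)
  have hs2 := measureReal_inter_add_sdiff (μ := prodBernoulli g) (s := R ∩ U) (hmeas C)
  rw [hon] at hs1 hs2
  have hC0 : 0 ≤ (prodBernoulli g).real C := measureReal_nonneg
  have hmul : (prodBernoulli g).real C * (prodBernoulli g').real (R ∩ openConn d b) ≤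
      (prodBernoulli g).real C * (prodBernoulli g').real (R ∩ U) := mul_le_mul_of_nonneg_left hK' hC0
  linarith

end FingerML3Reductions

end

end Summit.CriticalPhenomena.PercolationContinuityZ3.Theorems
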